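import Summits.Ventures.PercRepro.RankLevelSetLevelElevenGXTForm
import Summits.Ventures.PercRepro.RankLevelSetCoreElevenOfFormGXT
import Summits.Ventures.PercRepro.RankLevelSetCoreElevenLargeCorankGXT
import Summits.Ventures.PercRepro.RankLevelSetLevelTenGXTB
import Summits.Ventures.PercRepro.S3SixWindow

/-!
# PercRepro — THEOREM C₁₁ ON THE GIANT-EXACT COUNT WITH LEMMA T5: C-025 AT LEVEL `11` FOR EVERY FINITE MATROID AND EVERY
`p ≥ 865` (p2, gen 36; a feeder for S4 — the top of the `q = 11` window, from `1,554`)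

The level-`11` instance of the GXT chains of RankLevelSetLevelTenGXTB (level `10` from `403`): p8 g18's giant-exact count
(`S2.ncard_eRk_eq_ncard_le_le_giant_exact`) with the quartic multiplicity on the non-giant rank-`11` sets and the powerset of the
giant flat, p8's LEMMA T5 (`s₅ ≤ 7·d(d+1)(d+2)(d+3)/48`), the flat bounds `f(11) ≤ 1279`, `f(10) ≤ 639`
(RankLevelSetLevelElevenInfraGXT), the mid weight in CLOSED FORM (RankLevelSetLevelElevenSigmaBarGXT) and the TRUNCATED `Y`-tails
(the spanning tail never expanded): every cell `(p, d)`, `12 ≤ d ≤ 1387`, closes at the UNIFORM base `p ≥ 865` (the 1,376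
polynomial certificates of RankLevelSetLevelElevenGXTArith{AA…GP}, the tail bases of RankLevelSetLevelElevenGXTTails{AA…BQ},
the dispatcher `gxt_form_eleven`), and the large-corank regime closes from corank `1388` (`largeEleven_all_gxt`); the rows
`≤ 864` fail at the giant-powerset band `d = 1251 … 1268` on the `N`-side (`864` fails exactly at `(864, 1268)`), the rows
`≤ 750` already at the `639`-point-flat cells `(p, 517 … 583)`.
* **`c025_core_eleven_bounded_corank_gxt`** — the `e`-free core at level `11`, corank `12 ≤ d ≤ 1387`, rank `p ≥ 865`;
* **`c025_eleven_of_ten_gxt_from`** — for every `P ≥ 865`: level `10` for all `p ≥ P` implies level `11` for all `p ≥ P + 1`;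
* **`c025_eleven_at_eight_sixty_five`** — level `11` at rank `865`, every finite matroid (the per-rank wrapper
  `rls_succ_large_at 10 11 865` on level `10` at `864`, `c025_ten_large_gxtb'`);
* **`c025_eleven_large_gxt'`** — UNCONDITIONAL over the tree: level `11` for every `p ≥ 865`; **`c025_eleven_large_gxt`** the same
  in the literal `C025` body.
Axioms: standard.
-/

open scoped Matroid

namespace PercRepro

namespace ThmN

open Set

variable {α : Type}

/-- **The `e`-free core at level `11`, corank `12 ≤ d ≤ 1387`, rank `p ≥ 865`, on the giant-exact count with LEMMA T5**: the
form of the cell from `gxt_form_eleven` through `c025_core_eleven_of_form_gxt`. -/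
theorem c025_core_eleven_bounded_corank_gxt (M : Matroid α) [M.Finite] (p d : ℕ) (hp : 865 ≤ p) (hd12 : 12 ≤ d)
    (hd1387 : d ≤ 1387) (hR : M.eRank = (p : ℕ∞)) (hn : M.E.ncard = p + d)
    (hfree : ∀ e ∈ M.E, ∃ A ⊆ M.E \ {e}, e ∉ M.closure A ∧ e ∉ M.closure ((M.E \ {e}) \ A)) :
    RLS M p 11 :=
  c025_core_eleven_of_form_gxt M p d hd12 hR hn hfree (gxt_form_eleven d hd12 hd1387 p hp (p + d) (by omega))

/-- **THEOREM C₁₁ ON THE GIANT-EXACT COUNT WITH LEMMA T5, GIVEN LEVEL `10` FROM `P`**: for every `P ≥ 865`, level `10` for all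
`p ≥ P` implies level `11` for all `p ≥ P + 1` (the core at corank `12 ≤ d ≤ 1387` by `c025_core_eleven_bounded_corank_gxt`, at
corank `≥ 1388` by `c025_core_eleven_large_corank_gxt`; the coranks `≤ 11` are `U = ∅` or Theorem M). -/
theorem c025_eleven_of_ten_gxt_from (P : ℕ) (hP : 865 ≤ P)
    (h10 : ∀ (M : Matroid α) [M.Finite] (p : ℕ), P ≤ p → RLS M p 10) :
    ∀ (M : Matroid α) [M.Finite] (p : ℕ), P + 1 ≤ p → RLS M p 11 := by
  intro M _ p hp
  refine rls_succ_large (α := α) 10 11 P ?_ ?_ ?_ M p hp (by omega)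
  · intro M' _ p' hP' _
    exact h10 M' p' hP'
  · intro M' _ p' _ hn _
    rcases Nat.lt_or_ge M'.E.ncard (p' + 11) with h | h
    · exact RLS_of_ncard_lt M' h
    · exact RLS_of_ncard_eq M' (by omega)
  · intro M' _ p' hP' hR hbig _ hfree
    rcases Nat.lt_or_ge M'.E.ncard (p' + 1388) with h | h
    · exact c025_core_eleven_bounded_corank_gxt M' p' (M'.E.ncard - p') (by omega) (by omega) (by omega) hR
        (by omega) hfree
    · exact c025_core_eleven_large_corank_gxt M' p' (by omega) hR (by omega) hfree

/-- **Level `11` at rank `865`, every finite matroid**: `rls_succ_large_at 10 11 865` on level `10` at `864`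
(`c025_ten_large_gxtb'`), the coranks `≤ 11` (`U = ∅` or Theorem M) and the core at `865`. -/
theorem c025_eleven_at_eight_sixty_five (M : Matroid α) [M.Finite] : RLS M 865 11 := by
  refine rls_succ_large_at (α := α) 10 11 865 (by norm_num)
    (fun M _ => c025_ten_large_gxtb' M 864 (by norm_num)) ?_ ?_ M
  · -- corank `≤ 11`: `U = ∅` or Theorem M
    intro M _ hn
    rcases Nat.lt_or_ge M.E.ncard (865 + 11) with h | h
    · exact RLS_of_ncard_lt M h
    · exact RLS_of_ncard_eq M (by omega)
  · -- the core at corank `≥ 12`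
    intro M _ hR hbig hfree
    rcases Nat.lt_or_ge M.E.ncard (865 + 1388) with h | h
    · exact c025_core_eleven_bounded_corank_gxt M 865 (M.E.ncard - 865) (le_refl _) (by omega) (by omega) hR
        (by omega) hfree
    · exact c025_core_eleven_large_corank_gxt M 865 (le_refl _) hR (by omega) hfree

/-- **THEOREM C₁₁ AT `865`, UNCONDITIONAL OVER THE TREE**: every finite matroid satisfies C-025 at level `11` for every
`p ≥ 865` — the row `865` by `c025_eleven_at_eight_sixty_five`, the rows `≥ 866` through the wrapper at `P = 865` on level `10`
for `p ≥ 403` (`c025_ten_large_gxtb'`). -/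
theorem c025_eleven_large_gxt' (M : Matroid α) [M.Finite] (p : ℕ) (hp : 865 ≤ p) : RLS M p 11 := by
  rcases Nat.lt_or_ge p 866 with h | h
  · have h865 : p = 865 := by omega
    subst h865
    exact c025_eleven_at_eight_sixty_five M
  · exact c025_eleven_of_ten_gxt_from 865 (by norm_num)
      (fun M' _ p' hp' => c025_ten_large_gxtb' M' p' (by omega)) M p h

/-- The same in the literal `C025` body: `phiK p 11 · #U(p, 11) ≤ #Y(p, 11)` for every finite matroid and every `p ≥ 865`. -/
theorem c025_eleven_large_gxt (M : Matroid α) [M.Finite] (p : ℕ) (hp : 865 ≤ p) :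
    phiK p 11 * ({A : Set α | A ⊆ M.E ∧ M.eRk A = (p : ℕ∞) ∧ M.eRk (M.E \ A) = (11 : ℕ∞)}.ncard : ℚ) ≤
      ({A : Set α | A ⊆ M.E ∧ (11 : ℕ∞) < M.eRk A ∧ M.eRk A < (p : ℕ∞)}.ncard : ℚ) :=
  c025_eleven_large_gxt' M p hp

end ThmN

end PercRepro
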